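/-
Origin: expansion seat `prover-pub-hodgecm-mc-discharge-3-g7-0`, handover #4 15:30Z md5 d16eec1fb116 (370 l.; NEW additive KERNEL leaf, ns HodgeCM.Model.HypCensus; imports row #3 `HodgeCM.Model.HypCensus.ArchDatumPlaces` + binder-2 `HodgeCM.Model.HypCensus.ArchDatumCM` + `HodgeCM.Vendored.H21.NumberTheory.Weil1964.ArchDualPairNoPositiveCharacterSigns` (twin of p190021); 0 defs, 7 theorems: §1 `isArchWeilDatum_repTransport_archWeilRep_places_symm` (= row #3 with the positive-character sign profile in EITHER orientation per complex place — closes the (1,N−1)-orientation gap of rows #2/#3 vs `h₁V`'s 2nd disjunct — via row #2's `_of_archLocal` + tree `UnitaryGroup.mulPos_eq_one_archLocal_diagonal_symm`), `isArchWeilDatum_repTransport_archWeilRep_places_of_nonempty` (ONE kind-erased `AnyLeviKAKInput` per place, `Classical.choice`); §2 `isArchWeilDatum_repTransport_archWeilRep_places_canonical` (canonical frames `signSplit ∘ placeSignVec`, scalings `sqrtAbs`, `cW := im σ_{w(v)}(δ)/cV` — the frames of weil-2's `hasThetaMajorants_omega_pairSplitting_canonical` verbatim); §3 CM PIN: `realPlaceMap_cmRealVec`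 (rfl: `realPlaceMap L⁺ L c w _ _ (cmRealVec L d hd i) = re σ_w(d i)`), `realPlaceMap_profile_of_embeddings`, **`isArchWeilDatum_repTransport_cmArchWeilRep`** (frames εV εW / scalings DV DW / cV cW / htV htW hcc / Levi KAK inputs `I` SUPPLIED — the form for a consumer with its own frames, e.g. BRICK-4's block frame; remaining hyps only the sign profiles `hsV hsW` through complex embeddings, either orientation; conclusion `IsArchWeilDatum (archPairPhaseHom L conj N M e (IsCMField.complexConj_ne_one L) (cmPlaceOver L) (cmPlaceOver_smul L) (cmPlaceOver_comap L) (cmRealVec L dV hdV) (cmRealVec L dW hdW) (realDiagonal_map …).symm (realDiagonal_map …).symm εV εW hDV0 hDW0 hcV hcW htV htW) (repTransport (scaledFrame L⁺ (Fin n) (pairScale N M DV DW) …) (cmArchWeilRep L e dV hdV hdV0 dW hdW hdW0 hGR))`; discharged inside: `s := cmSplittingOf hGR`, `hs := proj_cmSplittingOf hGR`, `hscont := continuous_splittingOf … hGR`, `hfix := complexConj_smul_infinitePlace L`, `hc := IsCMField.complexConj_ne_one L`), `isArchWeilDatum_repTransport_cmArchWeilRep_of_nonempty`. 0 Prop defs,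 0 records, nothing cited, MODEL-N ±0, E unchanged; `ArchFactor`/`ArchDatum`/`ArchDatumCM`/rows #1–#3 bytes untouched (imports only). EVIDENCE: hub-farm `lean check` rc 0 / 0 sorries / 0 warnings, 54 s, 15:25Z, of the concatenation `mc/pub-hodgecm-mc-discharge-3/notes/check_pin_concat.lean` 429165be0a72 (= notes/check_all_concat.lean a1d865596360 [ArchFactor + ArchDatum + rows #1–#3] + ArchDatumCM 6b7b14981f04 body + tree leaf f8f155a4a338 inlined + rows #4 #5, imports de-vendored, 2123 l.; log notes/check_pin_concat.log); `#print axioms isArchWeilDatum_repTransport_cmArchWeilRep_of_signs_two` = trio. No private `lake` build from this seat.) (`HOME/mc/pub-hodgecm-mc-discharge-3/stage/HodgeCM/Model/HypCensus/ArchDatumPlacesCM.lean`, md5 d16eec1f, 369 lines);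
landed by the gen-12 packager (p-g12) in gate run 36 as `HodgeCM/Model/HypCensus/ArchDatumPlacesCM.lean` (verbatim).
-/
/-
Origin: speedrun cell pub-hodgecm, MODEL-CONSTRUCTION sub-cell, discharge seat mc-discharge-3 (unit pub-hodgecm-mc-discharge-3,
seat prover-pub-hodgecm-mc-discharge-3-g7-0, gen 7), ticket D-3 = BINDER-OWNERS §1a rows 10/16/17 sub-items (c2)+(c4) of binder-2's
`archWeilRep` ((J-arch) §3(b)/(c)) AT THE CM PIN (`ArchDatumCM`, binder-2-g6 6b7b14981f04), in weil-2's consumer currency, 2026-08-19.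
Target in PKG: `HodgeCM/Model/HypCensus/ArchDatumPlacesCM.lean` (NEW additive leaf = D-3 kit row #4; imports `ArchDatumPlaces` (row #3)
+ `ArchDatumCM` + the K-1 twin of the tree file `Weil1964/ArchDualPairNoPositiveCharacterSigns` p190021).  KERNEL only: 0 records /
named facts / defs, 0 proof holes.  Checked against the hub tree by concatenation with `ArchFactor.lean` 55e596e2a0dc / `ArchDatum.lean`
13e0d54cb896 / `ArchDatumCoeff` cf854e6a9240 / `ArchDatumLift` f72d05db6f7c / `ArchDatumPlaces` ed5134ac1dcf / `ArchDatumCM`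
6b7b14981f04 (imports de-vendored), farm rc 0.
-/
import Summits.HodgeConjecture.HodgeCM.Model.HypCensus.ArchDatumPlaces
import Summits.HodgeConjecture.HodgeCM.Model.HypCensus.ArchDatumCM
import Literature.NumberTheory.Weil1964.ArchDualPairNoPositiveCharacterSigns

/-!
# Census kit (rows A12/A34), junction (J-arch) at the CM pin: the archimedean Weil datum of `cmArchWeilRep` from SIGN FACTS

`ArchDatumPlaces` (row #3) gives the (J-arch) datum `IsArchWeilDatum (archPairPhaseHom …) (repTransport e_D (archWeilRep … s hs))`
for a GENERIC diagonal dual pair `J_V = diag(t_V) ⊗ 1`, `J_W = diag(t_W) ⊗ 1` over `E/F`, with the per-place sign frames, adapted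
scalings and Levi-form `KAK` inputs supplied.  This leaf is the `IsArchWeilDatum` twin of weil-2's majorant chain
`hasThetaMajorants_omega_pairSplitting → _of_nonempty → _canonical → hasThetaMajorants_cmPairSplitting (→ _canonical → _of_signs →
_of_signs_two)` (`Weil1964/ArchDualPairThetaMajorants` §1–§2), ending at THE pin of record:

* §1 `isArchWeilDatum_repTransport_archWeilRep_places_symm` — row #3 with the positive-character sign profile admitted in EITHER
  orientation at each complex place (`U(p,q)`, `min(p,q) ≤ 1`; tree `UnitaryGroup.mulPos_eq_one_archLocal_diagonal_symm`), and
  `…_places_of_nonempty` — ONE kind-erased Levi-form `KAK` input per place (`AnyLeviKAKInput`, `Classical.choice`);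
* §2 `isArchWeilDatum_repTransport_archWeilRep_places_canonical` — CANONICAL frames: at each real place `v` the factors are split
  by the signs of `σ_v(t_V)/c_V(v)` and `σ_v(t_W)·c_V(v)/im σ_{w(v)}(δ)` (`signSplit ∘ placeSignVec`), scalings `√|·|` (`sqrtAbs`);
* §3 THE CM PIN `F = L⁺`, `E = L`, `c` = complex conjugation, `J_V = diag d_V`, `J_W = diag d_W`, `s = cmSplittingOf hGR`
  (so that the representation is binder-2's `cmArchWeilRep L e dV … hGR` VERBATIM, an `abbrev`):
  `isArchWeilDatum_repTransport_cmArchWeilRep` (frames + `KAK` inputs supplied — the form a consumer with its OWN frames uses,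
  e.g. the block frame `DPIdx (Fin 2) Unit R S ⊕ σ₂` of `Model/ArchKTypeJunction` § 2) and `…_of_nonempty`; the sibling leaf
  `ArchDatumPlacesCMSigns` finishes the chain (`…_canonical`, **`…_of_signs`**, **`…_of_signs_two`** — from SIGN FACTS through
  complex embeddings ONLY, with the five binders `(ι₁ hGR h₁V h₁W hV)` of `hasThetaMajorants_cmPairSplitting_of_signs_two`, the
  `hρ` input of unitary-1's `wmInputCM₂s`).

Discharged inside (tree): `c ≠ 1` (`IsCMField.complexConj_ne_one`), the place dictionary `cmPlaceOver` / `_smul` / `_comap`,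
continuity of the chosen splitting (`continuous_splittingOf`, [GelbartRogawski1991, Prop. 3.1.1]), `c` fixes every infinite
place (`complexConj_smul_infinitePlace`), and the positive-character sign profiles in `realPlaceMap` currency from the sign facts
(`realPlaceMap L⁺ L c w … (cmRealVec L d hd i) = re σ_w(dᵢ)` definitionally).

Nothing here is a claim of PerL/QW8. [Folland1989, §4.2, the Schur remark p. 156; Weil1964, Chap. III n° 37–39] is the provenance
of the argument.  Style lint (L-notation): ONE `local notation` `γ𝕎[P, Q, R, S]` (as in the tree file `ArchDualPairThetaMajorants`),
its right-hand side captures NO section variable.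
-/

set_option autoImplicit false

noncomputable section

open NumberField NumberField.InfinitePlace IsDedekindDomain MeasureTheory
open scoped Matrix
open scoped Kronecker Classical TensorProduct ComplexConjugate
open Literature.NumberTheory.Automorphic Literature.NumberTheory.Automorphic.UnitaryGroup Literature.NumberTheory.Weil1964
open Literature.RepresentationTheory.HeisenbergGroup (polar Heisenberg symplecticGroup ofSymplectic)
open Literature.RepresentationTheory.KonnoKonno2007 Literature.RepresentationTheory.KonnoKonno2007.RealDualPair
open Literature.NumberTheory.GelbartRogawski1991 Literature.NumberTheory.GelbartRogawski1991.UnitaryDualPair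
open Literature.Analysis.SegalBargmann

-- Notation (NOT a definition), as in `Weil1964/ArchDualPairThetaMajorants`: the archimedean symplectic action of
-- `G_∞ = U(P,Q) × U(R,S)` on the polarised phase space, as phase maps.  Captures no section variable.
set_option quotPrecheck false in
local notation "γ𝕎[" P ", " Q ", " R ", " S "]" =>
  fun g : Ginf P Q R S => (⇑((ι𝕎 P Q R S g).1 :
    ((DPIdx P Q R S → ℝ) × (DPIdx P Q R S → ℝ)) ≃ₗ[ℝ] ((DPIdx P Q R S → ℝ) × (DPIdx P Q R S → ℝ))) :
      PhaseMap (DPIdx P Q R S))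

namespace HodgeCM.Model.HypCensus

/-! ## §1 Generic diagonal pair: either orientation of the sign profiles; kind-erased `KAK` inputs -/

section Places

variable {F : Type} [Field F] [NumberField F] (E : Type) [Field E] [NumberField E] [Algebra F E] (c : E ≃ₐ[F] E)
  (N M : ℕ) {m : ℕ} (e : Fin N × Fin M ≃ Fin m) (hc : c ≠ 1)
  (wOf : {v : InfinitePlace F // v.IsReal} → {w : InfinitePlace E // w.IsComplex})
  (hw : ∀ v, c • (wOf v).1 = (wOf v).1) (hover : ∀ v, (wOf v).1.comap (algebraMap F E) = v.1)
  (tV : Fin N → F) (tW : Fin M → F) {JV : Matrix (Fin N) (Fin N) E} {JW : Matrix (Fin M) (Fin M) E}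
  (hJV : JV = (Matrix.diagonal tV).map (algebraMap F E)) (hJW : JW = (Matrix.diagonal tW).map (algebraMap F E))
  [IsTotallyReal F] [Algebra.IsQuadraticExtension F E] {δ : E} (hcδ : c δ = -δ) (hδ : δ ≠ 0) {d : F}
  (hd : δ * δ = algebraMap F E d)

section Frames

variable {P Q R S : {v : InfinitePlace F // v.IsReal} → Type} [∀ v, Fintype (P v)] [∀ v, DecidableEq (P v)]
  [∀ v, Fintype (Q v)] [∀ v, DecidableEq (Q v)] [∀ v, Fintype (R v)] [∀ v, DecidableEq (R v)]
  [∀ v, Fintype (S v)] [∀ v, DecidableEq (S v)]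
  (εV : ∀ v, Fin N ≃ P v ⊕ Q v) (εW : ∀ v, Fin M ≃ R v ⊕ S v)
  {DV : {v : InfinitePlace F // v.IsReal} → Fin N → ℝ} {DW : {v : InfinitePlace F // v.IsReal} → Fin M → ℝ}
  (hDV0 : ∀ v i, DV v i ≠ 0) (hDW0 : ∀ v j, DW v j ≠ 0) {cV cW : {v : InfinitePlace F // v.IsReal} → ℝ}
  (hcV : ∀ v, cV v ≠ 0) (hcW : ∀ v, cW v ≠ 0)
  (htV : ∀ v i, embedding_of_isReal v.2 (tV i) = cV v * signOf (εV v i) * DV v i ^ 2)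
  (htW : ∀ v j, embedding_of_isReal v.2 (tW j) = cW v * signOf (εW v j) * DW v j ^ 2)

/-- **Row #3 in either orientation.**  Same as `isArchWeilDatum_repTransport_archWeilRep_places`, the positive-character
input being asked of `σ_v(t_V)` OR `−σ_v(t_V)` (and of `σ_v(t_W)` or `−σ_v(t_W)`) at each complex place: «at most one negative
entry, or negative everywhere» — i.e. `U(p,q)` with `min(p,q) ≤ 1`, both orientations (tree
`UnitaryGroup.mulPos_eq_one_archLocal_diagonal_symm`: `U(diag x) = U(diag(−x))`).
[Folland1989, §4.2, the Schur remark p. 156; Weil1964, Chap. III n° 37–39] -/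
theorem isArchWeilDatum_repTransport_archWeilRep_places_symm (hcc : ∀ v, cV v * cW v = ((wOf v).1.embedding δ).im)
    (hVd : IsUnit (Matrix.diagonal tV).det) (hWd : IsUnit (Matrix.diagonal tW).det)
    {Kk Pa : {v : InfinitePlace F // v.IsReal} → Type*} [∀ v, TopologicalSpace (Kk v)]
    [∀ v, TopologicalSpace (Pa v)] {κf : ∀ v, Kk v → Ginf (P v) (Q v) (R v) (S v)}
    {af : ∀ v, Pa v → Ginf (P v) (Q v) (R v) (S v)}
    (I : ∀ v, LeviKAKInput (γ𝕎[P v, Q v, R v, S v]) (κf v) (af v))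
    (s : UnitaryGroup.adelicPair F E c N M JV JW →*
      adelicMpCont F (Fin m) (UnitaryDualPair.adelicGram F e (Matrix.diagonal tV) (Matrix.diagonal tW)))
    (hs : ∀ g, adelicMpCont.proj F (Fin m) (UnitaryDualPair.adelicGram F e (Matrix.diagonal tV) (Matrix.diagonal tW)) (s g) =
      UnitaryDualPair.toSp F E c N M e JV JW hcδ hδ hd (Matrix.isSymm_diagonal tV) (Matrix.isSymm_diagonal tW) hJV hJW g)
    (hscont : Continuous s) (hfix : ∀ w : InfinitePlace E, c • w = w)
    (hprofV : ∀ w : {w : InfinitePlace E // w.IsComplex},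
      ((∃ i₀, ∀ i, i ≠ i₀ → 0 < UnitaryGroup.realPlaceMap F E c w (hfix w.1) hc (tV i)) ∨
          ∀ i, UnitaryGroup.realPlaceMap F E c w (hfix w.1) hc (tV i) < 0) ∨
        ((∃ i₀, ∀ i, i ≠ i₀ → UnitaryGroup.realPlaceMap F E c w (hfix w.1) hc (tV i) < 0) ∨
          ∀ i, 0 < UnitaryGroup.realPlaceMap F E c w (hfix w.1) hc (tV i)))
    (hprofW : ∀ w : {w : InfinitePlace E // w.IsComplex},
      ((∃ j₀, ∀ j, j ≠ j₀ → 0 < UnitaryGroup.realPlaceMap F E c w (hfix w.1) hc (tW j)) ∨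
          ∀ j, UnitaryGroup.realPlaceMap F E c w (hfix w.1) hc (tW j) < 0) ∨
        ((∃ j₀, ∀ j, j ≠ j₀ → UnitaryGroup.realPlaceMap F E c w (hfix w.1) hc (tW j) < 0) ∨
          ∀ j, 0 < UnitaryGroup.realPlaceMap F E c w (hfix w.1) hc (tW j))) :
    IsArchWeilDatum
      (archPairPhaseHom E c N M e hc wOf hw hover tV tW hJV hJW εV εW hDV0 hDW0 hcV hcW htV htW)
      (repTransport (scaledFrame F (Fin m) (pairScale N M (e := e) DV DW) (pairScale_ne_zero N M hDV0 hDW0))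
        (archWeilRep F E c N M JV JW hcδ hδ hd (Matrix.isSymm_diagonal tV) (Matrix.isSymm_diagonal tW) hVd hWd hJV hJW e
          s hs)) :=
  isArchWeilDatum_repTransport_archWeilRep_of_archLocal F E c N M JV JW hcδ hδ hd (Matrix.isSymm_diagonal tV)
    (Matrix.isSymm_diagonal tW) hVd hWd hJV hJW e s hs
    ((UnitaryDualPair.continuous_pairSplitting F E c N M e JV JW hscont).comp (continuous_archProdHom F E c N M JV JW))
    (scaledFrame F (Fin m) (pairScale N M (e := e) DV DW) (pairScale_ne_zero N M hDV0 hDW0))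
    (isUnit_archMat_of_isUnit _ (UnitaryDualPair.isUnit_adelicGram F e hVd hWd))
    (kakImplementerData_leviFamily_places_reindex (fun v => pairFrame (P v) (Q v) (R v) (S v) e (εV v) (εW v)) I)
    (fun u v => archPairPlace E c N M hc wOf hw hover tV tW hJV hJW εV εW hDV0 hDW0 hcV hcW htV htW v
      (archProdHom F E c N M JV JW u))
    (continuous_pi fun v =>
      (continuous_archPairPlace E c N M hc wOf hw hover tV tW hJV hJW εV εW hDV0 hDW0 hcV hcW htV htW v).comp
        (continuous_archProdHom F E c N M JV JW))
    (fun u pq => congrFun (archPhaseMap_toSp_pair E c N M e hc wOf hw hover tV tW hJV hJW εV εW hDV0 hDW0 hcV hcW htV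
      htW hcδ hδ hd (Matrix.isSymm_diagonal tV) (Matrix.isSymm_diagonal tW) hcc _
        (UnitaryGroup.archToAdelic F E c N JV u.1) (UnitaryGroup.archToAdelic F E c M JW u.2)) pq)
    (archPairPhaseHom E c N M e hc wOf hw hover tV tW hJV hJW εV εW hDV0 hDW0 hcV hcW htV htW) (fun _ _ => rfl) hc
    hfix
    (fun w => UnitaryGroup.mulPos_eq_one_archLocal_diagonal_symm F E c N JV w (hfix w.1) hc tV hJV
      (ne_zero_of_isUnit_det_diagonal hVd) (hprofV w))
    (fun w => UnitaryGroup.mulPos_eq_one_archLocal_diagonal_symm F E c M JW w (hfix w.1) hc tW hJW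
      (ne_zero_of_isUnit_det_diagonal hWd) (hprofW w))

/-- `isArchWeilDatum_repTransport_archWeilRep_places_symm` from ONE kind-erased Levi-form `KAK` input per place
(`AnyLeviKAKInput`, chosen by `Classical.choice`; the conclusion does not depend on the choice). [Folland1989, §4.2 (4.24)
p. 156, Prop. (4.39); Knapp2002, Thm 7.39] -/
theorem isArchWeilDatum_repTransport_archWeilRep_places_of_nonempty
    (hcc : ∀ v, cV v * cW v = ((wOf v).1.embedding δ).im)
    (hVd : IsUnit (Matrix.diagonal tV).det) (hWd : IsUnit (Matrix.diagonal tW).det)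
    (hI : ∀ v, Nonempty (AnyLeviKAKInput (γ𝕎[P v, Q v, R v, S v])))
    (s : UnitaryGroup.adelicPair F E c N M JV JW →*
      adelicMpCont F (Fin m) (UnitaryDualPair.adelicGram F e (Matrix.diagonal tV) (Matrix.diagonal tW)))
    (hs : ∀ g, adelicMpCont.proj F (Fin m) (UnitaryDualPair.adelicGram F e (Matrix.diagonal tV) (Matrix.diagonal tW)) (s g) =
      UnitaryDualPair.toSp F E c N M e JV JW hcδ hδ hd (Matrix.isSymm_diagonal tV) (Matrix.isSymm_diagonal tW) hJV hJW g)
    (hscont : Continuous s) (hfix : ∀ w : InfinitePlace E, c • w = w)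
    (hprofV : ∀ w : {w : InfinitePlace E // w.IsComplex},
      ((∃ i₀, ∀ i, i ≠ i₀ → 0 < UnitaryGroup.realPlaceMap F E c w (hfix w.1) hc (tV i)) ∨
          ∀ i, UnitaryGroup.realPlaceMap F E c w (hfix w.1) hc (tV i) < 0) ∨
        ((∃ i₀, ∀ i, i ≠ i₀ → UnitaryGroup.realPlaceMap F E c w (hfix w.1) hc (tV i) < 0) ∨
          ∀ i, 0 < UnitaryGroup.realPlaceMap F E c w (hfix w.1) hc (tV i)))
    (hprofW : ∀ w : {w : InfinitePlace E // w.IsComplex},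
      ((∃ j₀, ∀ j, j ≠ j₀ → 0 < UnitaryGroup.realPlaceMap F E c w (hfix w.1) hc (tW j)) ∨
          ∀ j, UnitaryGroup.realPlaceMap F E c w (hfix w.1) hc (tW j) < 0) ∨
        ((∃ j₀, ∀ j, j ≠ j₀ → UnitaryGroup.realPlaceMap F E c w (hfix w.1) hc (tW j) < 0) ∨
          ∀ j, 0 < UnitaryGroup.realPlaceMap F E c w (hfix w.1) hc (tW j))) :
    IsArchWeilDatum
      (archPairPhaseHom E c N M e hc wOf hw hover tV tW hJV hJW εV εW hDV0 hDW0 hcV hcW htV htW)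
      (repTransport (scaledFrame F (Fin m) (pairScale N M (e := e) DV DW) (pairScale_ne_zero N M hDV0 hDW0))
        (archWeilRep F E c N M JV JW hcδ hδ hd (Matrix.isSymm_diagonal tV) (Matrix.isSymm_diagonal tW) hVd hWd hJV hJW e
          s hs)) :=
  isArchWeilDatum_repTransport_archWeilRep_places_symm E c N M e hc wOf hw hover tV tW hJV hJW hcδ hδ hd εV εW hDV0 hDW0
    hcV hcW htV htW hcc hVd hWd (fun v => (Classical.choice (hI v)).input) s hs hscont hfix hprofV hprofW

end Frames

/-! ## §2 Canonical sign frames and scalings -/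

/-- **The (J-arch) datum in CANONICAL FRAMES.**  Same as `isArchWeilDatum_repTransport_archWeilRep_places_of_nonempty` with the
sign frames and scalings CHOSEN: at each real place `v` the first factor is split by the signs of `σ_v(t_V)/c_V(v)` and the
second by the signs of `σ_v(t_W)·c_V(v)/im σ_{w(v)}(δ)` (`c_V` any nowhere-zero real function — the consumer's freedom to decide
which block is "positive"), scalings `√|·|` (exactly the frames of `hasThetaMajorants_omega_pairSplitting_canonical`).  The only
archimedean input left is ONE kind-erased Levi-form `KAK` input per place for the real pair `U(PosIdx, NegIdx) × U(PosIdx, NegIdx)`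
(`nonempty_anyLeviKAKInput_of_card_le_one` / `_of_compact_left`) and the sign profiles (either orientation).
[Folland1989, §4.2, the Schur remark p. 156, (4.24), Prop. (4.39); Knapp2002, Thm 7.39; Weil1964, Chap. III n° 37–39] -/
theorem isArchWeilDatum_repTransport_archWeilRep_places_canonical
    (cV : {v : InfinitePlace F // v.IsReal} → ℝ) (hcV : ∀ v, cV v ≠ 0)
    (hVd : IsUnit (Matrix.diagonal tV).det) (hWd : IsUnit (Matrix.diagonal tW).det)
    (hI : ∀ v, Nonempty (AnyLeviKAKInput
      (γ𝕎[PosIdx (placeSignVec tV cV v), NegIdx (placeSignVec tV cV v),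
        PosIdx (placeSignVec tW (fun v => ((wOf v).1.embedding δ).im / cV v) v),
        NegIdx (placeSignVec tW (fun v => ((wOf v).1.embedding δ).im / cV v) v)])))
    (s : UnitaryGroup.adelicPair F E c N M JV JW →*
      adelicMpCont F (Fin m) (UnitaryDualPair.adelicGram F e (Matrix.diagonal tV) (Matrix.diagonal tW)))
    (hs : ∀ g, adelicMpCont.proj F (Fin m) (UnitaryDualPair.adelicGram F e (Matrix.diagonal tV) (Matrix.diagonal tW)) (s g) =
      UnitaryDualPair.toSp F E c N M e JV JW hcδ hδ hd (Matrix.isSymm_diagonal tV) (Matrix.isSymm_diagonal tW) hJV hJW g)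
    (hscont : Continuous s) (hfix : ∀ w : InfinitePlace E, c • w = w)
    (hprofV : ∀ w : {w : InfinitePlace E // w.IsComplex},
      ((∃ i₀, ∀ i, i ≠ i₀ → 0 < UnitaryGroup.realPlaceMap F E c w (hfix w.1) hc (tV i)) ∨
          ∀ i, UnitaryGroup.realPlaceMap F E c w (hfix w.1) hc (tV i) < 0) ∨
        ((∃ i₀, ∀ i, i ≠ i₀ → UnitaryGroup.realPlaceMap F E c w (hfix w.1) hc (tV i) < 0) ∨
          ∀ i, 0 < UnitaryGroup.realPlaceMap F E c w (hfix w.1) hc (tV i)))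
    (hprofW : ∀ w : {w : InfinitePlace E // w.IsComplex},
      ((∃ j₀, ∀ j, j ≠ j₀ → 0 < UnitaryGroup.realPlaceMap F E c w (hfix w.1) hc (tW j)) ∨
          ∀ j, UnitaryGroup.realPlaceMap F E c w (hfix w.1) hc (tW j) < 0) ∨
        ((∃ j₀, ∀ j, j ≠ j₀ → UnitaryGroup.realPlaceMap F E c w (hfix w.1) hc (tW j) < 0) ∨
          ∀ j, 0 < UnitaryGroup.realPlaceMap F E c w (hfix w.1) hc (tW j))) :
    IsArchWeilDatum
      (archPairPhaseHom E c N M e hc wOf hw hover tV tW hJV hJW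
        (fun v => signSplit (placeSignVec tV cV v))
        (fun v => signSplit (placeSignVec tW (fun v => ((wOf v).1.embedding δ).im / cV v) v))
        (DV := fun v => sqrtAbs (placeSignVec tV cV v))
        (DW := fun v => sqrtAbs (placeSignVec tW (fun v => ((wOf v).1.embedding δ).im / cV v) v))
        (fun v i => sqrtAbs_ne_zero (div_ne_zero ((map_ne_zero _).2 (ne_zero_of_isUnit_det_diagonal hVd i)) (hcV v)))
        (fun v j => sqrtAbs_ne_zero (div_ne_zero ((map_ne_zero _).2 (ne_zero_of_isUnit_det_diagonal hWd j))
          (div_ne_zero (UnitaryGroup.im_embedding_delta_ne_zero F E c (wOf v) (hw v) hc hcδ hδ) (hcV v))))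
        (cV := cV) (cW := fun v => ((wOf v).1.embedding δ).im / cV v) hcV
        (fun v => div_ne_zero (UnitaryGroup.im_embedding_delta_ne_zero F E c (wOf v) (hw v) hc hcδ hδ) (hcV v))
        (fun v i => eq_mul_signOf_signSplit_mul_sqrtAbs_sq (hcV v) (fun j => embedding_of_isReal v.2 (tV j)) i
          ((map_ne_zero _).2 (ne_zero_of_isUnit_det_diagonal hVd i)))
        (fun v j => eq_mul_signOf_signSplit_mul_sqrtAbs_sq
          (div_ne_zero (UnitaryGroup.im_embedding_delta_ne_zero F E c (wOf v) (hw v) hc hcδ hδ) (hcV v))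
          (fun j => embedding_of_isReal v.2 (tW j)) j ((map_ne_zero _).2 (ne_zero_of_isUnit_det_diagonal hWd j))))
      (repTransport
        (scaledFrame F (Fin m)
          (pairScale N M (e := e) (fun v => sqrtAbs (placeSignVec tV cV v))
            (fun v => sqrtAbs (placeSignVec tW (fun v => ((wOf v).1.embedding δ).im / cV v) v)))
          (pairScale_ne_zero N M
            (fun v i => sqrtAbs_ne_zero (div_ne_zero ((map_ne_zero _).2 (ne_zero_of_isUnit_det_diagonal hVd i)) (hcV v)))
            (fun v j => sqrtAbs_ne_zero (div_ne_zero ((map_ne_zero _).2 (ne_zero_of_isUnit_det_diagonal hWd j))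
              (div_ne_zero (UnitaryGroup.im_embedding_delta_ne_zero F E c (wOf v) (hw v) hc hcδ hδ) (hcV v))))))
        (archWeilRep F E c N M JV JW hcδ hδ hd (Matrix.isSymm_diagonal tV) (Matrix.isSymm_diagonal tW) hVd hWd hJV hJW e
          s hs)) :=
  isArchWeilDatum_repTransport_archWeilRep_places_of_nonempty E c N M e hc wOf hw hover tV tW hJV hJW hcδ hδ hd _ _ _ _ hcV
    _ _ _ (fun v => by rw [← mul_div_assoc, mul_div_cancel_left₀ _ (hcV v)]) hVd hWd hI s hs hscont hfix hprofV hprofW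

end Places

/-! ## §3 The CM pin: `cmArchWeilRep L e dV … hGR` -/

section CMPin

variable (L : Type) [Field L] [NumberField L] [IsCMField L] {N M n : ℕ} (e : Fin N × Fin M ≃ Fin n)
variable (dV : Fin N → L) (hdV : ∀ i, IsCMField.complexConj L (dV i) = dV i) (hdV0 : ∀ i, dV i ≠ 0)
variable (dW : Fin M → L) (hdW : ∀ i, IsCMField.complexConj L (dW i) = dW i) (hdW0 : ∀ i, dW i ≠ 0)
variable (hGR : (cmSplittingDatum L e dV hdV hdV0 dW hdW hdW0).CompatibleSplitting)

/-- `realPlaceMap L⁺ L c w (cmRealVec L d hd i) = re σ_w(dᵢ)` (definitional). -/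
theorem realPlaceMap_cmRealVec (w : {w : InfinitePlace L // w.IsComplex})
    (hw : IsCMField.complexConj L • w.1 = w.1) {K : ℕ} (d : Fin K → L) (hd : ∀ i, IsCMField.complexConj L (d i) = d i)
    (i : Fin K) :
    UnitaryGroup.realPlaceMap (↥(maximalRealSubfield L)) L (IsCMField.complexConj L) w hw (IsCMField.complexConj_ne_one L)
      (cmRealVec L d hd i) = (w.1.embedding (d i)).re := rfl

/-- the sign profiles through complex embeddings (either orientation) give the `realPlaceMap` profiles asked by §1. -/
theorem realPlaceMap_profile_of_embeddings {K : ℕ} (d : Fin K → L) (hd : ∀ i, IsCMField.complexConj L (d i) = d i)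
    (hsgn : ∀ τ : L →+* ℂ,
      ((∃ i₀, ∀ i, i ≠ i₀ → 0 < (τ (d i)).re) ∨ ∀ i, (τ (d i)).re < 0) ∨
        ((∃ i₀, ∀ i, i ≠ i₀ → (τ (d i)).re < 0) ∨ ∀ i, 0 < (τ (d i)).re))
    (w : {w : InfinitePlace L // w.IsComplex}) :
    ((∃ i₀, ∀ i, i ≠ i₀ → 0 < UnitaryGroup.realPlaceMap (↥(maximalRealSubfield L)) L (IsCMField.complexConj L) w
          (complexConj_smul_infinitePlace L w.1) (IsCMField.complexConj_ne_one L) (cmRealVec L d hd i)) ∨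
        ∀ i, UnitaryGroup.realPlaceMap (↥(maximalRealSubfield L)) L (IsCMField.complexConj L) w
          (complexConj_smul_infinitePlace L w.1) (IsCMField.complexConj_ne_one L) (cmRealVec L d hd i) < 0) ∨
      ((∃ i₀, ∀ i, i ≠ i₀ → UnitaryGroup.realPlaceMap (↥(maximalRealSubfield L)) L (IsCMField.complexConj L) w
          (complexConj_smul_infinitePlace L w.1) (IsCMField.complexConj_ne_one L) (cmRealVec L d hd i) < 0) ∨
        ∀ i, 0 < UnitaryGroup.realPlaceMap (↥(maximalRealSubfield L)) L (IsCMField.complexConj L) w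
          (complexConj_smul_infinitePlace L w.1) (IsCMField.complexConj_ne_one L) (cmRealVec L d hd i)) :=
  hsgn w.1.embedding

section Frames

variable {P Q R S : {v : InfinitePlace ↥(maximalRealSubfield L) // v.IsReal} → Type} [∀ v, Fintype (P v)]
  [∀ v, DecidableEq (P v)] [∀ v, Fintype (Q v)] [∀ v, DecidableEq (Q v)] [∀ v, Fintype (R v)]
  [∀ v, DecidableEq (R v)] [∀ v, Fintype (S v)] [∀ v, DecidableEq (S v)]

/-- **The (J-arch) datum of the CM pin — frames, scalings and `KAK` inputs SUPPLIED** (the consumer's own frames, e.g. the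
block frame of `Model/ArchKTypeJunction` § 2 at the place of `ι₁`).  For the CM dual pair `(U(diag d_V), U(diag d_W))` over
`L/L⁺` with its chosen compatible splitting (`cmSplittingOf hGR`, [GelbartRogawski1991, Prop. 3.1.1]), per-place sign frames
`ε_V v : Fin N ≃ P_v ⊕ Q_v`, `ε_W v`, adapted scalings (`σ_v d_V = c_V ε_V D_V²`, `σ_v d_W = c_W ε_W D_W²`, `c_V c_W = im σ_{w(v)}(δ_L)`),
a family of Levi-form `KAK` inputs for the real pairs `U(P_v,Q_v) × U(R_v,S_v)`, and the sign profiles of `d_V`, `d_W` through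
every complex embedding (at most one entry of the minority sign, either orientation):
`IsArchWeilDatum (archPairPhaseHom …) (repTransport e_D (cmArchWeilRep L e dV … hGR))`.
[Folland1989, §4.2, the Schur remark p. 156, (4.24), Prop. (4.39); Knapp2002, Thm 7.39; GelbartRogawski1991, §3.1 Prop. 3.1.1
p. 455; Weil1964, Chap. III n° 37–39] -/
theorem isArchWeilDatum_repTransport_cmArchWeilRep
    (εV : ∀ v, Fin N ≃ P v ⊕ Q v) (εW : ∀ v, Fin M ≃ R v ⊕ S v)
    {DV : {v : InfinitePlace ↥(maximalRealSubfield L) // v.IsReal} → Fin N → ℝ}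
    {DW : {v : InfinitePlace ↥(maximalRealSubfield L) // v.IsReal} → Fin M → ℝ}
    (hDV0 : ∀ v i, DV v i ≠ 0) (hDW0 : ∀ v j, DW v j ≠ 0)
    {cV cW : {v : InfinitePlace ↥(maximalRealSubfield L) // v.IsReal} → ℝ} (hcV : ∀ v, cV v ≠ 0)
    (hcW : ∀ v, cW v ≠ 0)
    (htV : ∀ v i, embedding_of_isReal v.2 (cmRealVec L dV hdV i) = cV v * signOf (εV v i) * DV v i ^ 2)
    (htW : ∀ v j, embedding_of_isReal v.2 (cmRealVec L dW hdW j) = cW v * signOf (εW v j) * DW v j ^ 2)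
    (hcc : ∀ v, cV v * cW v =
      ((cmPlaceOver L v).1.embedding (imagUnit L)).im)
    {Kk Pa : {v : InfinitePlace ↥(maximalRealSubfield L) // v.IsReal} → Type*} [∀ v, TopologicalSpace (Kk v)]
    [∀ v, TopologicalSpace (Pa v)] {κf : ∀ v, Kk v → Ginf (P v) (Q v) (R v) (S v)}
    {af : ∀ v, Pa v → Ginf (P v) (Q v) (R v) (S v)}
    (I : ∀ v, LeviKAKInput (γ𝕎[P v, Q v, R v, S v]) (κf v) (af v))
    (hsV : ∀ τ : L →+* ℂ,
      ((∃ i₀, ∀ i, i ≠ i₀ → 0 < (τ (dV i)).re) ∨ ∀ i, (τ (dV i)).re < 0) ∨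
        ((∃ i₀, ∀ i, i ≠ i₀ → (τ (dV i)).re < 0) ∨ ∀ i, 0 < (τ (dV i)).re))
    (hsW : ∀ τ : L →+* ℂ,
      ((∃ j₀, ∀ j, j ≠ j₀ → 0 < (τ (dW j)).re) ∨ ∀ j, (τ (dW j)).re < 0) ∨
        ((∃ j₀, ∀ j, j ≠ j₀ → (τ (dW j)).re < 0) ∨ ∀ j, 0 < (τ (dW j)).re)) :
    IsArchWeilDatum
      (archPairPhaseHom L (IsCMField.complexConj L) N M e (IsCMField.complexConj_ne_one L) (cmPlaceOver L)
        (cmPlaceOver_smul L) (cmPlaceOver_comap L) (cmRealVec L dV hdV) (cmRealVec L dW hdW)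
        (realDiagonal_map L dV hdV).symm
        (realDiagonal_map L dW hdW).symm εV εW hDV0 hDW0 hcV hcW htV htW)
      (repTransport
        (scaledFrame (↥(maximalRealSubfield L)) (Fin n) (pairScale N M (e := e) DV DW) (pairScale_ne_zero N M hDV0 hDW0))
        (cmArchWeilRep L e dV hdV hdV0 dW hdW hdW0 hGR)) :=
  isArchWeilDatum_repTransport_archWeilRep_places_symm L (IsCMField.complexConj L) N M e (IsCMField.complexConj_ne_one L)
    (cmPlaceOver L) (cmPlaceOver_smul L) (cmPlaceOver_comap L) (cmRealVec L dV hdV) (cmRealVec L dW hdW)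
    (realDiagonal_map L dV hdV).symm
    (realDiagonal_map L dW hdW).symm
    (complexConj_imagUnit L)
    (imagUnit_ne_zero L)
    (imagUnit_mul_self L)
    εV εW hDV0 hDW0 hcV hcW htV htW hcc
    (isUnit_det_realDiagonal L dV hdV hdV0)
    (isUnit_det_realDiagonal L dW hdW hdW0) I
    (cmSplittingOf L e dV hdV hdV0 dW hdW hdW0 hGR) (proj_cmSplittingOf L e dV hdV hdV0 dW hdW hdW0 hGR)
    (continuous_splittingOf _ _ _ _ _ _ _ _ _ _ _ _ _ _ _ _ _ hGR)
    (complexConj_smul_infinitePlace L)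
    (realPlaceMap_profile_of_embeddings L dV hdV hsV) (realPlaceMap_profile_of_embeddings L dW hdW hsW)

/-- `isArchWeilDatum_repTransport_cmArchWeilRep` from ONE kind-erased Levi-form `KAK` input per place. [Folland1989, §4.2 (4.24)
p. 156, Prop. (4.39); Knapp2002, Thm 7.39] -/
theorem isArchWeilDatum_repTransport_cmArchWeilRep_of_nonempty
    (εV : ∀ v, Fin N ≃ P v ⊕ Q v) (εW : ∀ v, Fin M ≃ R v ⊕ S v)
    {DV : {v : InfinitePlace ↥(maximalRealSubfield L) // v.IsReal} → Fin N → ℝ}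
    {DW : {v : InfinitePlace ↥(maximalRealSubfield L) // v.IsReal} → Fin M → ℝ}
    (hDV0 : ∀ v i, DV v i ≠ 0) (hDW0 : ∀ v j, DW v j ≠ 0)
    {cV cW : {v : InfinitePlace ↥(maximalRealSubfield L) // v.IsReal} → ℝ} (hcV : ∀ v, cV v ≠ 0)
    (hcW : ∀ v, cW v ≠ 0)
    (htV : ∀ v i, embedding_of_isReal v.2 (cmRealVec L dV hdV i) = cV v * signOf (εV v i) * DV v i ^ 2)
    (htW : ∀ v j, embedding_of_isReal v.2 (cmRealVec L dW hdW j) = cW v * signOf (εW v j) * DW v j ^ 2)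
    (hcc : ∀ v, cV v * cW v =
      ((cmPlaceOver L v).1.embedding (imagUnit L)).im)
    (hI : ∀ v, Nonempty (AnyLeviKAKInput (γ𝕎[P v, Q v, R v, S v])))
    (hsV : ∀ τ : L →+* ℂ,
      ((∃ i₀, ∀ i, i ≠ i₀ → 0 < (τ (dV i)).re) ∨ ∀ i, (τ (dV i)).re < 0) ∨
        ((∃ i₀, ∀ i, i ≠ i₀ → (τ (dV i)).re < 0) ∨ ∀ i, 0 < (τ (dV i)).re))
    (hsW : ∀ τ : L →+* ℂ,
      ((∃ j₀, ∀ j, j ≠ j₀ → 0 < (τ (dW j)).re) ∨ ∀ j, (τ (dW j)).re < 0) ∨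
        ((∃ j₀, ∀ j, j ≠ j₀ → (τ (dW j)).re < 0) ∨ ∀ j, 0 < (τ (dW j)).re)) :
    IsArchWeilDatum
      (archPairPhaseHom L (IsCMField.complexConj L) N M e (IsCMField.complexConj_ne_one L) (cmPlaceOver L)
        (cmPlaceOver_smul L) (cmPlaceOver_comap L) (cmRealVec L dV hdV) (cmRealVec L dW hdW)
        (realDiagonal_map L dV hdV).symm
        (realDiagonal_map L dW hdW).symm εV εW hDV0 hDW0 hcV hcW htV htW)
      (repTransport
        (scaledFrame (↥(maximalRealSubfield L)) (Fin n) (pairScale N M (e := e) DV DW) (pairScale_ne_zero N M hDV0 hDW0))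
        (cmArchWeilRep L e dV hdV hdV0 dW hdW hdW0 hGR)) :=
  isArchWeilDatum_repTransport_cmArchWeilRep L e dV hdV hdV0 dW hdW hdW0 hGR εV εW hDV0 hDW0 hcV hcW htV htW hcc
    (fun v => (Classical.choice (hI v)).input) hsV hsW

end Frames

end CMPin

end HodgeCM.Model.HypCensus

end
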